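import Summits.ResolutionOfSingularities.ResolutionOfSingularities.Theorems.FrobeniusClosingSteerStrippedThreadBlock
import Summits.ResolutionOfSingularities.ResolutionOfSingularities.Theorems.FrobeniusClosingSteerRadicandRenormalisation
import Summits.ResolutionOfSingularities.ResolutionOfSingularities.Theorems.FrobeniusClosingSteerThreadChain
import HarnessLib

/-!
# Stripped threads, part 3b: the eternal isolated STRIPPED radicand chain of an infinitely-stripped thread (Θ1♭ engine)

W4.1, crux `Steer` (stmt-ResolutionOfSingularities-16345), σ-line, §σ2.25 v2.1 piece F-A3 `StrippedThreadTwoN` (Θ1♭ packaging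
theorem, res-L0-w41-plan-1 RULINGS 25/25′/27a/30a/36/74/77; owner res-D-pv-003; consult res-D-pv-011 AS res-L0-w41-stub-7, whose
finitely-hit engine `ThreadChain.not_noEternalChain_of_thread` (p515983) is the template). Theses-free, def-free.

## The theorem (`StrippedThread.not_noEternalStrippedChain_of_thread`)

DATA = p515983's binders VERBATIM (the W4.1 tower `R` with its centres `P`, strict steps, radicands `s i ^ p ∈ R i`, regular members,
VISITS `j` of an infinite thread with thread primes `W m`, heights `c` / multiplicity / minimality at the visits) EXCEPT: the NO-HIT
clause is REPLACED by «every hit off the visits (`P m ≤ W m`) is a prime of height `≤ 1` which is SINGULAR for `s m ^ p`» (`hhit`) and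
«there are hits beyond every stage» (`hinf`); ADDED: the thread centres have regular quotients (`hquot`, the permissibility clause) and
the CLEANER DESCENT principle (`hCD`, res-L0-w41-tri-2 (L2) / res-L0-w41-stub-4's lemma, taken by NAME in the leaf — RULING 74 (R2)).
CONCLUSION: the body of `NoEternalStrippedRadicandChain p c` (§σ2.25 v2.1, with the free exponents `e m ≥ 1`, `2 ≤ e m` infinitely often,
isolatedness kept) FAILS.

## Construction (RULING 36b; indexing of record after the FINDING 2026-08-27T10:12Z)

Member `k` = the germ `S k = (R (j (k+1)))_{P (j (k+1))} = T (j k + 1)` at visit `k+1` (p515983's member; constant along the block after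
visit `k` by identity steps — p514807 — AND by the height-one hits, which are trivial on the member: part 1 p520316). Block `k`
(`block_decomposition`, part 3a p524060): `s (j k) = U_k · ξ_k^(n_k+1) · s (j (k+1)) + B_k` with `ξ_k = xx (j k)` the visit's
exceptional parameter, `U_k` a unit of `S k`, `B_k ∈ R (j (k+1))`, `n_k` = the number of hits (each strips `ξ_k`: the hit lemma p522759).
CLEANER DESCENT on `B_(k+1)` inside `S k ≤ S (k+1)`: `B_(k+1) = g′ + ξ_(k+1)^(n_(k+1)+1)·L`, `g′ ∈ S k`, `L ∈ S (k+1)`. Renormalised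
radicands `f k = (c_k)^p · s (j (k+1))^p + (h_k)^p` with `c 0 = 1`, `c (k+1) = c_k·U_(k+1)`, `h 0 = 0`, `h (k+1) = c_k·L`; cleaner
`g k = c_k·g′ + h_k ∈ S k`; parameter `x k = ξ_(k+1)`; exponent `e k = n_(k+1) + 1`. The law is res-D-pv-007's
`RadicandRenorm.law_of_cleanerDescent'` (p522643), multiplicity and isolatedness travel along `T ↦ c·T + h`
(`RadicandRenorm.exists_sub_pow_mem_renorm`, `RadicandRenorm.isolated_renorm`) from the visit's clauses
(`GeoDict.isRegularLocalRing_localization_atPrime_adjoinRoot_of_forall_lt`, res-type-096 p502861), `hinf` from the hits.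
OURS (the W4.1 engine). [cite: Cutkosky2014, §2.1] [cite: NovacoskiSpivakovsky2014, Def. 2.11] [cite: Matsumura1987, Thm. 19.3, Thm. 20.3]
-/

noncomputable section

-- `Summit.<S>.<S>.…` duplicates the summit name by design (single-problem summit).
set_option linter.dupNamespace false

open Polynomial IsLocalRing Literature.AlgebraicGeometry.Resolution

namespace Summit.ResolutionOfSingularities.ResolutionOfSingularities.Theorems.SwitchingDichotomy.StrippedThread

variable {k : Type} {K : Type} [Field k] [Field K] [Algebra k K]

/-- **Θ1♭ — an infinitely STRIPPED thread is an eternal isolated stripped radicand chain.** See the module docstring for the data,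
the construction and the bricks. OURS (the W4.1 engine; §σ2.25 v2.1 F-A3).
[cite: Cutkosky2014, §2.1] [cite: NovacoskiSpivakovsky2014, Def. 2.11] [cite: Matsumura1987, Thm. 19.3, Thm. 20.3] -/
theorem not_noEternalStrippedChain_of_thread (p : ℕ) [hp : Fact p.Prime] [CharP K p]
    (O : ValuationSubring K) (A₀ : Subalgebra k K) (h₀ : A₀.toSubring ≤ O.toSubring) (hfg : A₀.FG)
    (R : ℕ → Subring K) (P : (i : ℕ) → Ideal (R i)) (s : ℕ → K) (c : ℕ)
    (hR0 : R 0 = locAtCentre A₀.toSubring O)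
    (hbl : ∀ i, IsLocalBlowupAlong O (R i) (P i) (R (i + 1)))
    (hst : ∀ i, ∃ x g : K, ((∃ hx : x ∈ R i, (⟨x, hx⟩ : R i) ∈ P i) ∧ x ≠ 0 ∧
      ∀ y : R i, y ∈ P i → O.valuation (y : K) ≤ O.valuation x) ∧ g ∈ R i ∧ s i = x * s (i + 1) + g)
    (hsp : ∀ i, s i ^ p ∈ R i)
    (hregR : ∀ i, IsRegularLocalRing (R i))
    (j : ℕ → ℕ) (hj : StrictMono j)
    (W : (m : ℕ) → Ideal (R m)) (hWprime : ∀ m, j 0 ≤ m → (W m).IsPrime)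
    (hWP : ∀ k, W (j k) = P (j k))
    (hWcomap : ∀ m, j 0 ≤ m → ∃ h : R m ≤ R (m + 1), Ideal.comap (Subring.inclusion h) (W (m + 1)) = W m)
    (hhit : ∀ m, j 0 ≤ m → (∀ k, m ≠ j k) → P m ≤ W m → ∃ _ : (P m).IsPrime, (P m).height ≤ 1 ∧
      ¬ IsRegularLocalRing (AdjoinRoot ((X : (Localization.AtPrime (P m))[X]) ^ p -
        C (algebraMap (R m) (Localization.AtPrime (P m)) ⟨s m ^ p, hsp m⟩))))
    (hinf : ∀ m₀, ∃ m, m₀ ≤ m ∧ (∀ k, m ≠ j k) ∧ P m ≤ W m)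
    (hht : ∀ k, (P (j k)).height = c)
    (hquot : ∀ k, IsRegularLocalRing (R (j k) ⧸ P (j k)))
    (hmult : ∀ k, ∃ g : R (j k), (⟨s (j k) ^ p, hsp (j k)⟩ : R (j k)) - g ^ p ∈ P (j k) ^ p)
    (hmin : ∀ k, ∀ (Q : Ideal (R (j k))) [Q.IsPrime], Q < P (j k) →
      IsRegularLocalRing (AdjoinRoot ((X : (Localization.AtPrime Q)[X]) ^ p -
        C (algebraMap (R (j k)) (Localization.AtPrime Q) ⟨s (j k) ^ p, hsp (j k)⟩))))
    (hCD : ∀ (S S' : Subring K) [IsRegularLocalRing S] [IsRegularLocalRing S'] (hle : S ≤ S'),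
      IsQuadraticTransform S S' → ∀ (ξ : K) (hξ : ξ ∈ S'),
      Ideal.span ((fun y : S => (⟨(y : K), hle y.2⟩ : S')) '' (maximalIdeal S : Set S)) = Ideal.span {(⟨ξ, hξ⟩ : S')} →
      ∀ (f G F : K), f ∈ S → G ∈ S' → F ∈ S' → ∀ e : ℕ, 1 ≤ e → f - G ^ p = ξ ^ (p * e) * F →
      ∃ g h : K, g ∈ S ∧ h ∈ S' ∧ G = g + ξ ^ e * h) :
    ¬ (∀ (L : Type) [Field L] [CharP L p] (S : ℕ → Subring L) [∀ m, IsLocalRing (S m)]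
        (hle : ∀ m, S m ≤ S (m + 1)) (f g : ∀ m, S m) (x : ∀ m, S (m + 1)) (e : ℕ → ℕ) (_he : ∀ m, 1 ≤ e m)
        (_hinf : ∀ m₀, ∃ m, m₀ ≤ m ∧ 2 ≤ e m),
        (∀ m, IsRegularLocalRing (S m)) → (∀ m, IsExcellentRing (S m)) → (∀ m, ringKrullDim (S m) = c) →
        (∀ m, IsQuadraticTransform (S m) (S (m + 1))) →
        (∀ m, Ideal.span ((fun y : S m => (⟨(y : L), hle m y.2⟩ : S (m + 1))) '' (maximalIdeal (S m) : Set (S m)))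
            = Ideal.span {x m}) →
        (∀ m, ((f (m + 1) : S (m + 1)) : L) * ((x m : S (m + 1)) : L) ^ (p * e m) =
            ((f m : S m) : L) - ((g m : S m) : L) ^ p) →
        (∀ m, ∃ h : S m, f m - h ^ p ∈ maximalIdeal (S m) ^ p) →
        (∀ m, ∀ (Q : Ideal (AdjoinRoot ((X : (S m)[X]) ^ p - C (f m)))) [Q.IsPrime],
            (∃ Q' : Ideal (AdjoinRoot ((X : (S m)[X]) ^ p - C (f m))), Q'.IsPrime ∧ Q < Q') →
            IsRegularLocalRing (Localization.AtPrime Q)) →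
        False) := by
  intro hNo
  classical
  -- ### indices
  have hj0 : ∀ k, j 0 ≤ j k := fun k => hj.monotone (Nat.zero_le k)
  have hjlt : ∀ k, j k < j (k + 1) := fun k => hj (Nat.lt_succ_self k)
  have hjle : ∀ k, k ≤ j k := fun k => hj.id_le k
  have hnotvisit : ∀ k m, j k < m → m < j (k + 1) → ∀ k', m ≠ j k' := by
    intro k m h1 h2 k' he
    subst he
    have a1 : k < k' := hj.lt_iff_lt.mp h1
    have a2 : k' < k + 1 := hj.lt_iff_lt.mp h2
    omega
  haveI hPprime : ∀ k, (P (j k)).IsPrime := fun k => hWP k ▸ hWprime (j k) (hj0 k)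
  -- ### the tower: monotone, each member its own local ring at the centre of `O`
  have hmono : Monotone R := monotone_nat_of_le_succ fun i => (hbl i).isLocalBlowup.le
  have hRO : ∀ i, R i ≤ O.toSubring := fun i => (hbl i).1
  have hloc : ∀ i, locAtCentre (R i) O = R i := by
    intro i
    cases i with
    | zero => rw [hR0, locAtCentre_locAtCentre]
    | succ i => exact (hbl i).isLocalBlowup.locAtCentre_eq
  haveI : ∀ i, IsLocalRing (R i) := fun i => by haveI := hregR i; infer_instance
  choose hRR hWW using hWcomap
  have hWcomap' : ∀ m d, j 0 ≤ m →
      Ideal.comap (Subring.inclusion (hmono (Nat.le_add_right m d))) (W (m + d)) = W m := by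
    intro m d hm
    induction d with
    | zero =>
      ext y
      simp only [Ideal.mem_comap]
      rfl
    | succ d ih =>
      have h1 := hWW (m + d) (by omega)
      rw [← ih, ← h1, Ideal.comap_comap]
      rfl
  have hWcomap'' : ∀ m m' (hm : j 0 ≤ m) (hmm' : m ≤ m'),
      Ideal.comap (Subring.inclusion (hmono hmm')) (W m') = W m := by
    intro m m' hm hmm'
    obtain ⟨d, rfl⟩ := Nat.exists_eq_add_of_le hmm'
    exact hWcomap' m d hm
  -- ### strict-transform data
  choose xx gg hxg using hst
  have hxx : ∀ i, (∃ hx : xx i ∈ R i, (⟨xx i, hx⟩ : R i) ∈ P i) ∧ xx i ≠ 0 ∧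
      ∀ y : R i, y ∈ P i → O.valuation (y : K) ≤ O.valuation (xx i) := fun i => (hxg i).1
  have hxR : ∀ i, xx i ∈ R i := fun i => (hxg i).1.1.1
  have hxP : ∀ i, (⟨xx i, hxR i⟩ : R i) ∈ P i := fun i => (hxg i).1.1.2
  have hx0 : ∀ i, xx i ≠ 0 := fun i => (hxg i).1.2.1
  have hxmax : ∀ i, ∀ y : R i, y ∈ P i → O.valuation (y : K) ≤ O.valuation (xx i) := fun i => (hxg i).1.2.2
  have hgR : ∀ i, gg i ∈ R i := fun i => (hxg i).2.1
  have hsx : ∀ i, s i = xx i * s (i + 1) + gg i := fun i => (hxg i).2.2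
  -- ### the germs `T m = (R m)_{W m}`
  have hTex : ∀ m, ∃ T : Subring K, j 0 ≤ m → ∀ z : K, z ∈ T ↔ ∃ a b : R m, b ∉ W m ∧ z = (a : K) / b := by
    intro m
    by_cases hm : j 0 ≤ m
    · haveI := hWprime m hm
      obtain ⟨T, hT⟩ := GeoDict.exists_locChar (R m) (W m)
      exact ⟨T, fun _ => hT⟩
    · exact ⟨⊥, fun h => absurd h hm⟩
  choose T hT using hTex
  -- ### identity steps AND divisor steps: `T (m+1) = T m` off the visits
  have hident : ∀ m, j 0 ≤ m → (∀ k, m ≠ j k) → T (m + 1) = T m := by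
    intro m hm hnv
    haveI := hWprime m hm
    haveI := hWprime (m + 1) (by omega)
    haveI := hregR m
    by_cases hPW : P m ≤ W m
    · -- a hit: the centre has height one, the step is trivial on the member
      obtain ⟨hPm, hh1, -⟩ := hhit m hm hnv hPW
      haveI := hPm
      have hP1 : (P m).height = 1 := height_eq_one_of_isLocalBlowupAlong (hbl m) hh1
      have hR' : R (m + 1) = locAtCentre (R m) O := eq_locAtCentre_of_divisorStep (hloc m) hP1 (hbl m)
      exact ThreadChain.locChar_eq_of_le (hRR m hm) (hWW m hm) (hT m hm) (hT (m + 1) (by omega)) hR'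
        (GeoDict.le_of_locChar (hT m hm))
    · -- an identity step (p514807)
      obtain ⟨hRO', u, u₀, hu, hu₀, hu00, hval, hR'⟩ := hbl m
      have hu₀P : u₀ ∈ P m := hu ▸ Ideal.subset_span (Finset.mem_coe.mpr hu₀)
      have h0' : ((u₀ : R m) : K) ≠ 0 := fun e => hu00 (Subtype.ext e)
      have hdiv : ∀ y : R m, y ∈ P m → (y : K) / ((u₀ : R m) : K) ∈ R (m + 1) := by
        intro y hy
        rw [hR']
        refine le_locAtCentre _ O ?_
        rw [SteeredMembersRegular.closure_div_eq_of_span_eq (R m) ((u₀ : R m) : K) (↑u : Set (R m)) hu]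
        exact SteeredMembersRegular.div_mem_closure_div _ hy
      have hu₀W : u₀ ∉ W m := by
        have := ThreadChain.not_mem_of_not_le (hRR m hm) (hWW m hm) (P := P m) (u₀ : R m).2 h0' hdiv hPW
        simpa using this
      exact ThreadChain.locChar_eq_of_le (hRR m hm) (hWW m hm) (hT m hm) (hT (m + 1) (by omega)) hR'
        (ThreadChain.closure_le_of_not_mem (hT m hm) hu₀W _)
  have hblockT : ∀ k d, j k + 1 + d ≤ j (k + 1) → T (j k + 1 + d) = T (j k + 1) := by
    intro k d
    induction d with
    | zero => intro; rfl
    | succ d ih =>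
      intro hd
      have h1 : T (j k + 1 + d + 1) = T (j k + 1 + d) :=
        hident (j k + 1 + d) (by have := hj0 k; omega) (hnotvisit k (j k + 1 + d) (by omega) (by omega))
      rw [show j k + 1 + (d + 1) = j k + 1 + d + 1 by omega, h1, ih (by omega)]
  have hTblock : ∀ k m, j k < m → m ≤ j (k + 1) → T m = T (j k + 1) := by
    intro k m h1 h2
    have := hblockT k (m - (j k + 1)) (by omega)
    rwa [show j k + 1 + (m - (j k + 1)) = m by omega] at this
  -- ### the chain rings `S k = (R (j (k+1)))_{P (j (k+1))} = T m` for `j k < m ≤ j (k+1)`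
  let S : ℕ → Subring K := fun k => T (j (k + 1))
  have hS : ∀ k, ∀ z : K, z ∈ S k ↔ ∃ a b : R (j (k + 1)), b ∉ P (j (k + 1)) ∧ z = (a : K) / b := by
    intro k z
    have := hT (j (k + 1)) (hj0 _) z
    rw [hWP] at this
    exact this
  have hSm : ∀ k m, j k < m → m ≤ j (k + 1) → ∀ z : K, z ∈ S k ↔ ∃ a b : R m, b ∉ W m ∧ z = (a : K) / b := by
    intro k m h1 h2 z
    change z ∈ T (j (k + 1)) ↔ _
    rw [hTblock k (j (k + 1)) (hjlt k) le_rfl, ← hTblock k m h1 h2]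
    exact hT m (by have := hj0 k; omega) z
  have hS' : ∀ k, ∀ z : K, z ∈ S k ↔ ∃ a b : R (j k + 1), b ∉ W (j k + 1) ∧ z = (a : K) / b :=
    fun k => hSm k (j k + 1) (Nat.lt_succ_self _) (hjlt k)
  haveI hSloc : ∀ k, IsLocalRing (S k) := fun k => GeoDict.isLocalRing_of_locChar (hS k)
  haveI hWp1 : ∀ k, (W (j k + 1)).IsPrime := fun k => hWprime _ (by have := hj0 k; omega)
  haveI hSreg : ∀ k, IsRegularLocalRing (S k) := fun k => by
    haveI := hregR (j (k + 1))
    exact GeoDict.isRegularLocalRing_of_locChar (hS k)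
  have hRS : ∀ k, R (j (k + 1)) ≤ S k := fun k => GeoDict.le_of_locChar (hS k)
  have hRS' : ∀ k, R (j k + 1) ≤ S k := fun k => GeoDict.le_of_locChar (hS' k)
  have hPcomap : ∀ k, Ideal.comap (Subring.inclusion (hRR (j k) (hj0 k))) (W (j k + 1)) = P (j k) := by
    intro k
    rw [hWW (j k) (hj0 k), hWP]
  have hle : ∀ k, S k ≤ S (k + 1) := fun k =>
    GeoDict.le_of_locChar_of_comap (hRR (j (k + 1)) (hj0 _)) (hPcomap (k + 1)) (hS k) (hS' (k + 1))
  -- the chain clauses that do not involve the radicands: quadratic transform and `hspan`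
  have hqt : ∀ k, IsQuadraticTransform (S k) (S (k + 1)) := fun k =>
    GeoDict.isQuadraticTransform_of_isLocalBlowupAlong (hbl (j (k + 1))) (hRR (j (k + 1)) (hj0 _))
      (hPcomap (k + 1)) (hS k) (hS' (k + 1))
  have hξS : ∀ k, xx (j (k + 1)) ∈ S (k + 1) := fun k => hle k (hRS k (hxR _))
  have hspan : ∀ k, Ideal.span ((fun y : S k => (⟨(y : K), hle k y.2⟩ : S (k + 1))) '' (maximalIdeal (S k) : Set (S k)))
      = Ideal.span {(⟨xx (j (k + 1)), hξS k⟩ : S (k + 1))} := by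
    intro k
    have hdiv := GeoDict.exists_mem_mul_of_isExcParamAlong (hbl (j (k + 1))) ⟨hxR _, hxP _⟩ (hx0 _) (hxmax _)
    exact GeoDict.span_image_maximalIdeal_eq_of_locChar (hRR (j (k + 1)) (hj0 _)) (hPcomap (k + 1)) (hS k)
      (hS' (k + 1)) (hle k) ⟨xx (j (k + 1)), hxR _⟩ (hxP _) hdiv (hξS k)
  -- ### the blocks: `s (j k) = U_k · ξ_k^(n_k+1) · s (j (k+1)) + B_k`
  have hblock : ∀ k, ∃ (n : ℕ) (U B : K), U ∈ S k ∧ U⁻¹ ∈ S k ∧ U ≠ 0 ∧ B ∈ R (j (k + 1)) ∧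
      s (j k) = U * xx (j k) ^ (n + 1) * s (j (k + 1)) + B ∧
      ((∃ m, j k < m ∧ m < j (k + 1) ∧ P m ≤ W m) → 1 ≤ n) := by
    intro k
    exact block_decomposition p R P W s xx gg hregR hRO hloc hmono hbl hxx hgR hsx hsp (j k) (j (k + 1)) (hjlt k)
      (hquot k) (fun m h1 h2 => hWprime m (by have := hj0 k; omega))
      (fun m h1 h2 => hWW m (by have := hj0 k; omega))
      (fun m h1 h2 => by rw [hWcomap'' (j k) m (hj0 k) h1.le, hWP])
      (fun m h1 h2 => hSm k m h1 h2)
      (fun m h1 h2 hPW => hhit m (by have := hj0 k; omega) (hnotvisit k m h1 h2) hPW)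
      (fun Q _ hQ => hmin k Q hQ)
  choose nb Ub Bb hUb hUbinv hUb0 hBb hsb hnb using hblock
  -- ### cleaner descent on `B_(k+1)` inside `S k ≤ S (k+1)`
  have hdesc : ∀ k, ∃ g L : K, g ∈ S k ∧ L ∈ S (k + 1) ∧
      Bb (k + 1) = g + xx (j (k + 1)) ^ (nb (k + 1) + 1) * L := by
    intro k
    refine hCD (S k) (S (k + 1)) (hle k) (hqt k) (xx (j (k + 1))) (hξS k) (hspan k)
      (s (j (k + 1)) ^ p) (Bb (k + 1)) (Ub (k + 1) ^ p * s (j (k + 2)) ^ p)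
      (hRS k (hsp _)) (hRS (k + 1) (hBb (k + 1)))
      ((S (k + 1)).mul_mem ((S (k + 1)).pow_mem (hUb (k + 1)) p) (hRS (k + 1) (hsp _)))
      (nb (k + 1) + 1) (Nat.succ_le_succ (Nat.zero_le _)) ?_
    have h := hsb (k + 1)
    have : s (j (k + 1)) - Bb (k + 1) = xx (j (k + 1)) ^ (nb (k + 1) + 1) * (Ub (k + 1) * s (j (k + 2))) := by
      rw [h]; ring
    rw [← sub_pow_char, this, mul_pow, mul_pow, ← pow_mul, mul_comm (nb (k + 1) + 1) p]
  choose gd Ld hgd hLd hBd using hdesc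
  -- ### the renormalisation data `c`, `h`
  let cc : ℕ → K := fun k => Nat.rec (motive := fun _ => K) 1 (fun k ck => ck * Ub (k + 1)) k
  let hh : ℕ → K := fun k => Nat.rec (motive := fun _ => K) 0 (fun k _ => cc k * Ld k) k
  have hcc0 : cc 0 = 1 := rfl
  have hccs : ∀ k, cc (k + 1) = cc k * Ub (k + 1) := fun k => rfl
  have hhh0 : hh 0 = 0 := rfl
  have hhhs : ∀ k, hh (k + 1) = cc k * Ld k := fun k => rfl
  have hccS : ∀ k, cc k ∈ S k ∧ (cc k)⁻¹ ∈ S k ∧ cc k ≠ 0 := by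
    intro k
    induction k with
    | zero => exact ⟨by rw [hcc0]; exact (S 0).one_mem, by rw [hcc0, inv_one]; exact (S 0).one_mem, by rw [hcc0]; exact one_ne_zero⟩
    | succ k ih =>
      obtain ⟨h1, h2, h3⟩ := ih
      refine ⟨?_, ?_, ?_⟩
      · rw [hccs]; exact (S (k + 1)).mul_mem (hle k h1) (hUb (k + 1))
      · rw [hccs, mul_inv]; exact (S (k + 1)).mul_mem (hle k h2) (hUbinv (k + 1))
      · rw [hccs]; exact mul_ne_zero h3 (hUb0 (k + 1))
  have hhhS : ∀ k, hh k ∈ S k := by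
    intro k
    cases k with
    | zero => rw [hhh0]; exact (S 0).zero_mem
    | succ k => rw [hhhs]; exact (S (k + 1)).mul_mem (hle k (hccS k).1) (hLd k)
  -- ### chain data
  let f : ∀ k, S k := fun k => ⟨cc k ^ p * s (j (k + 1)) ^ p + hh k ^ p,
    (S k).add_mem ((S k).mul_mem ((S k).pow_mem (hccS k).1 p) (hRS k (hsp _))) ((S k).pow_mem (hhhS k) p)⟩
  let g : ∀ k, S k := fun k => ⟨cc k * gd k + hh k, (S k).add_mem ((S k).mul_mem (hccS k).1 (hgd k)) (hhhS k)⟩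
  let x : ∀ k, S (k + 1) := fun k => ⟨xx (j (k + 1)), hξS k⟩
  let e : ℕ → ℕ := fun k => nb (k + 1) + 1
  -- the unit `c k` of `S k` and the renormalisation identity `f k = (c k)^p · s^p + (h k)^p`
  have hcunit : ∀ k, IsUnit (⟨cc k, (hccS k).1⟩ : S k) := fun k =>
    (isUnit_subring_iff_inv_mem _).mpr ⟨(hccS k).2.2, (hccS k).2.1⟩
  have hfren : ∀ k, f k = (⟨cc k, (hccS k).1⟩ : S k) ^ p * ⟨s (j (k + 1)) ^ p, hRS k (hsp _)⟩ + ⟨hh k, hhhS k⟩ ^ p :=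
    fun k => Subtype.ext rfl
  -- ### the obligations of the chain
  refine @hNo K _ _ S hSloc hle f g x e (fun m => Nat.succ_le_succ (Nat.zero_le _)) (fun m₀ => ?_)
    hSreg (fun m => ?_) (fun m => ?_) hqt hspan (fun m => ?_) (fun m => ?_) (fun m => ?_)
  · -- `hinf`: a hit beyond `j (m₀+1)` lies in some block `k ≥ m₀ + 1`, so `e (k-1) ≥ 2`
    obtain ⟨m, hm, hnv, hPW⟩ := hinf (j (m₀ + 1) + 1)
    have hex : ∃ k, m < j k := ⟨m + 1, Nat.lt_of_lt_of_le (Nat.lt_succ_self m) (hjle (m + 1))⟩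
    set k₁ := Nat.find hex with hk₁
    have hk₁spec : m < j k₁ := Nat.find_spec hex
    have hk₁min : ∀ k, m < j k → k₁ ≤ k := fun k hk => Nat.find_min' hex hk
    have hk₁pos : m₀ + 1 < k₁ := by
      by_contra hle'
      have : j k₁ ≤ j (m₀ + 1) := hj.monotone (not_lt.mp hle')
      omega
    obtain ⟨k, hk⟩ : ∃ k, k₁ = k + 1 := ⟨k₁ - 1, by omega⟩
    have hjk : j k < m := by
      have h1 : ¬ m < j k := fun h => by have := hk₁min k h; omega
      have h2 : m ≠ j k := hnv k
      omega
    have hmk : m < j (k + 1) := hk ▸ hk₁spec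
    obtain ⟨k', hk'⟩ : ∃ k', k = k' + 1 := ⟨k - 1, by omega⟩
    refine ⟨k', by omega, ?_⟩
    change 2 ≤ nb (k' + 1) + 1
    have := hnb (k' + 1) ⟨m, by rw [← hk']; exact hjk, by rw [← hk']; exact hmk, hPW⟩
    omega
  · -- excellence (model + Stacks 07QW/07QU)
    obtain ⟨A₁, -, -, hfg₁, hRA₁⟩ := SteeredExit.exists_model_of_tower O A₀ h₀ hfg hR0 (N := j (m + 1))
      fun i _ => (hbl i).isLocalBlowup
    exact GeoDict.isExcellentRing_of_locChar O A₁ hfg₁ hRA₁ (hS m)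
  · -- dimension = height = c
    rw [GeoDict.ringKrullDim_of_locChar (hS m), hht]
    rfl
  · -- the law (res-D-pv-007's `law_of_cleanerDescent'`)
    have hrun : s (j (m + 1)) = xx (j (m + 1)) ^ (nb (m + 1) + 1) * Ub (m + 1) * s (j (m + 2)) + Bb (m + 1) := by
      rw [hsb (m + 1)]; ring
    have := RadicandRenorm.law_of_cleanerDescent' p (c := cc m) (M := hh m) hrun (hBd m)
    change (cc (m + 1) ^ p * s (j (m + 2)) ^ p + hh (m + 1) ^ p) * xx (j (m + 1)) ^ (p * (nb (m + 1) + 1)) =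
      (cc m ^ p * s (j (m + 1)) ^ p + hh m ^ p) - (cc m * gd m + hh m) ^ p
    rw [hccs, hhhs]
    exact this
  · -- cleaned multiplicity, from the permissible centre at the visit `j (m+1)`
    obtain ⟨γ, hγ⟩ := hmult (m + 1)
    have hmem := GeoDict.mem_maximalIdeal_pow_of_locChar (hS m) hγ
    rw [hfren m]
    refine RadicandRenorm.exists_sub_pow_mem_renorm p rfl ⟨⟨(γ : K), hRS m γ.2⟩, ?_⟩
    have heq : (⟨s (j (m + 1)) ^ p, hRS m (hsp _)⟩ : S m) - ⟨(γ : K), hRS m γ.2⟩ ^ p =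
        ⟨(((⟨s (j (m + 1)) ^ p, hsp _⟩ : R (j (m + 1))) - γ ^ p : R (j (m + 1))) : K),
          GeoDict.le_of_locChar (hS m) ((⟨s (j (m + 1)) ^ p, hsp _⟩ : R (j (m + 1))) - γ ^ p).2⟩ :=
      Subtype.ext rfl
    rw [heq]
    exact hmem
  · -- isolatedness from minimality at the visit (res-type-096 p502861), renormalised (res-D-pv-007 p522643)
    intro Q hQp hQ
    haveI : Q.IsPrime := hQp
    haveI := hregR (j (m + 1))
    letI : Algebra (R (j (m + 1))) (S m) := (Subring.inclusion (hRS m)).toAlgebra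
    haveI : IsLocalization.AtPrime (S m) (P (j (m + 1))) := GeoDict.isLocalization_of_locChar (hS m) fun r => rfl
    have hisol : ∀ (Q : Ideal (AdjoinRoot ((X : (S m)[X]) ^ p - C (⟨s (j (m + 1)) ^ p, hRS m (hsp _)⟩ : S m))))
        [Q.IsPrime], (∃ Q' : Ideal (AdjoinRoot ((X : (S m)[X]) ^ p - C (⟨s (j (m + 1)) ^ p, hRS m (hsp _)⟩ : S m))),
          Q'.IsPrime ∧ Q < Q') → IsRegularLocalRing (Localization.AtPrime Q) :=
      fun Q hQp hQ => @GeoDict.isRegularLocalRing_localization_atPrime_adjoinRoot_of_forall_lt (R (j (m + 1))) _ p _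
        (⟨s (j (m + 1)) ^ p, hsp _⟩ : R (j (m + 1))) (P (j (m + 1))) _ (S m) _ _ _ _
        (fun Q' hQ'p hQ' => by haveI := hQ'p; exact hmin (m + 1) Q' hQ') Q hQp hQ
    exact RadicandRenorm.isolated_renorm p (w := (⟨hh m, hhhS m⟩ : S m)) (hcunit m) (hfren m) hisol Q hQ

end Summit.ResolutionOfSingularities.ResolutionOfSingularities.Theorems.SwitchingDichotomy.StrippedThread

end
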